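import Summits.ResolutionOfSingularities.ResolutionOfSingularities.Theorems.EquisingularLiftEquisingularLiftNatTowerEmbRoundOfFactAny
import Summits.ResolutionOfSingularities.ResolutionOfSingularities.Theorems.EquisingularLiftEquisingularLiftNatTowerRoundFiveDefs
import Summits.ResolutionOfSingularities.ResolutionOfSingularities.Theorems.EquisingularLiftEquisingularLiftNatTowerFullDim
import Summits.ResolutionOfSingularities.ResolutionOfSingularities.Theorems.EquisingularLiftEquisingularLiftNatNoseTowerSeed
import Summits.ResolutionOfSingularities.ResolutionOfSingularities.Theorems.EquisingularLiftEquisingularLiftNatTowerRootsDischarge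
import Summits.ResolutionOfSingularities.ResolutionOfSingularities.Theorems.EquisingularLiftEquisingularLiftNatTowerSideFacts
import Summits.ResolutionOfSingularities.ResolutionOfSingularities.Theorems.EquisingularLiftEquisingularLiftNatTowerConeRoundThree
import Summits.ResolutionOfSingularities.ResolutionOfSingularities.Theorems.EquisingularLiftEquisingularLiftNatTowerConeRoundOldThree
import Summits.ResolutionOfSingularities.ResolutionOfSingularities.Theorems.EquisingularLiftEquisingularLiftNatTowerPtStepsInvThree
import Summits.ResolutionOfSingularities.ResolutionOfSingularities.Theorems.EquisingularLiftEquisingularLiftNatTowerInvDefs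
import Summits.ResolutionOfSingularities.ResolutionOfSingularities.Theorems.EquisingularLiftEquisingularLiftNatCentreCodimTwoAdapters
import Summits.ResolutionOfSingularities.ResolutionOfSingularities.Theorems.EquisingularLiftEquisingularLiftCentreBlowupFlatExceptional

import Summits.ResolutionOfSingularities.ResolutionOfSingularities.Theorems.EquisingularLiftEquisingularLiftNatTowerBDoublePrimeRoundClosure
import HarnessLib

/-!
# [OURS · L1 W4.5(b) · EL♮(3)] HSUB″(ReachNoseTowerB″)₃ — THE ENGINE OF THE T23-A″ NOSE RUNG (`stub_elnat_defNoseTowerBDoublePrimeResolutionThree`)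
# = p613108 `hsub_reachNoseTowerBPrime_of_fact` re-cut over `TowerRoundBDoublePrime` (res-L1-w45b-lead-2, …NatTowerRoundBDoublePrimeDefs) with the round
# clause = this seat's shared closure `Tower.towerRoundBDoublePrime_invB_of_fact` (…NatTowerBDoublePrimeRoundClosure: A′ rounds + the PAIR round)
res-L1-w45b-stub-4 g11 (T23-A / A′ / A″ engine owner; engine word `L/res-L1-w45b-stub-4/T23Adprime-ENGINE-WORD.md` 16d03a46d50c8ccd §4, desk R20 «nose″»).
OURS; NOT a statement of any manuscript ([Hironaka2017] is a candidate under adjudication, nothing of it is asserted); AI-written, weaker than expert review.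
No `sorry`; standard axioms; DEF-FREE; `--supports stmt-ResolutionOfSingularities-20148 --as helper`. Seed / point clauses / final = p613108 VERBATIM (adapted
copy); the conclusion's closure hypothesis ranges over `TowerRoundBDoublePrime` and carries `∃ Es'`, matching `ReachNoseTowerBDoublePrime`.
-/

set_option linter.dupNamespace false -- mandated namespace `Summit.<Summit>.<Problem>` of this single-conjunct summit
set_option linter.overlappingInstances false -- signatures carry `[IsDomain O] [IsDiscreteValuationRing O]`

noncomputable section

open CategoryTheory CategoryTheory.Limits AlgebraicGeometry TopologicalSpace Topology IsLocalRing
open Literature.AlgebraicGeometry.Resolution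
open AlgebraicGeometry.Scheme.IdealSheafData
open Summit.ResolutionOfSingularities.ResolutionOfSingularities.Theses.EquisingularLift.Split
open Summit.ResolutionOfSingularities.ResolutionOfSingularities.Cruxes.EquisingularLift.StrataSplit

namespace Summit.ResolutionOfSingularities.ResolutionOfSingularities.Cruxes.EquisingularLiftNat.Sections

/-- **HSUB″(ReachNoseTowerB″)₃ — the engine of DEF-NOSE-TOWER-B″** (module docstring). [cite: GortzWedhorn2020, Prop. 13.91 and (13.19)]
[cite: Liu2002, §8.1 and Thm. 8.1.19] [OURS · L1 W4.5b · T23-A″ engine] toward `stub_elnat_defNoseTowerBDoublePrimeResolutionThree`; NOT a statement of the manuscript. -/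
theorem hsub_reachNoseTowerBDoublePrime_of_fact (k : Type) [Field k]
    (O : Type) [CommRing O] [IsDomain O] [IsDiscreteValuationRing O] [IsAdicComplete (IsLocalRing.maximalIdeal O) O]
    [IsAlgClosed (IsLocalRing.ResidueField O)] (θ : O →+* k) (hθ : Function.Surjective θ)
    (P : Scheme.{0}) (q : P ⟶ Spec (.of O)) (Y : Set P) (Ch : ∀ X' : Scheme.{0}, (X' ⟶ P) → Set X' → Prop)
    (hChStep : ∀ (X' X'' : Scheme.{0}) (σ' : X' ⟶ P) (S' : Set X') (C : X'.IdealSheafData) (τ : X'' ⟶ X'),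
      Ch X' σ' S' → IsBlowup τ C → Scheme.IsRegular C.subscheme → Flat (C.subschemeι ≫ σ' ≫ q) →
      σ' '' (C.support : Set X') ⊆ {y | ¬ IsGenericPoint y Y} → (C.support : Set X') ∩ (σ' ≫ q) ⁻¹' {IsLocalRing.closedPoint O} ⊆ S' →
      Ch X'' (τ ≫ σ') (closure (τ ⁻¹' (S' \ (C.support : Set X')))))
    (hChSplit : ∀ (X' : Scheme.{0}) (σ' : X' ⟶ P) (S' : Set X'), Ch X' σ' S' → Chain P Y X' σ' S')
    (hYsp : Y ⊆ q ⁻¹' {IsLocalRing.closedPoint O}) (hYirr : IsIrreducible Y) (hYcl : IsClosed Y) (hPint : IsIntegral P)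
    (hPnoeth : IsLocallyNoetherian P) (hPreg : Scheme.IsRegular P) (hqprop : IsProper q) (hqsm : SmoothOfRelativeDimension 3 q)
    -- the stage before the nose and its model
    (X' : Scheme.{0}) (σ' : X' ⟶ P) (S' : Set X') (_hCh' : Ch X' σ' S') (_hX'int : IsIntegral X') (hX'noeth : IsLocallyNoetherian X')
    (hX'reg : Scheme.IsRegular X') (_hX'dom : IsDominant (σ' ≫ q)) (F₁ : Scheme.{0}) (_hF₁ : IsIntegral F₁) (j : F₁ ⟶ X')
    (t : F₁ ⟶ Spec (.of k)) (hsq : IsPullback j t (σ' ≫ q) (Spec.map (CommRingCat.ofHom θ))) (T₁ : Set F₁) (_hT₁cl : IsClosed T₁)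
    (_hT₁irr : IsIrreducible T₁) (_hjT₁ : j '' T₁ = S')
    -- the NOSE block
    (Z : Set F₁) (hZ : IsClosed Z) (_hZT₁ : Z ⊆ T₁) (hT₁Z : ¬ (T₁ ⊆ Z)) (hZinf : Z.Infinite)
    (hZdim : ∀ z : ↥(redSub F₁ Z hZ), IsClosed ({z} : Set ↥(redSub F₁ Z hZ)) →
      ringKrullDim ((redSub F₁ Z hZ).presheaf.stalk z) = ((1 : ℕ) : WithBot ℕ∞))
    (C : X'.IdealSheafData) (_hCsm : Smooth (C.subschemeι ≫ σ' ≫ q)) (hCreg : Scheme.IsRegular C.subscheme) (hCfl : Flat (C.subschemeι ≫ σ' ≫ q))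
    (hCj : C.comap j = vanishingIdeal (⟨Z, hZ⟩ : Closeds F₁)) (hCoff : ∀ c ∈ (C.support : Set X'), ¬ IsGenericPoint (σ' c) Y)
    (X₁ : Scheme.{0}) (τ₁ : X₁ ⟶ X') (hτ₁ : IsBlowup τ₁ C) (hX₁int : IsIntegral X₁) (hX₁noeth : IsLocallyNoetherian X₁)
    (hX₁reg : Scheme.IsRegular X₁) (hX₁dom : IsDominant ((τ₁ ≫ σ') ≫ q)) (F₂ : Scheme.{0}) (hF₂ : IsIntegral F₂) (υ : F₂ ⟶ F₁)
    (hυ : IsBlowup υ (vanishingIdeal (⟨Z, hZ⟩ : Closeds F₁))) (j₂ : F₂ ⟶ X₁) (t₂ : F₂ ⟶ Spec (.of k))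
    (hsq₂ : IsPullback j₂ t₂ ((τ₁ ≫ σ') ≫ q) (Spec.map (CommRingCat.ofHom θ))) (hcomm : j₂ ≫ τ₁ = υ ≫ j)
    (_hexc : (C.comap τ₁).comap j₂ = (vanishingIdeal (⟨Z, hZ⟩ : Closeds F₁)).comap υ)
    (hirr₂ : IsIrreducible (closure (υ ⁻¹' (T₁ \ Z)))) (hCh₁ : Ch X₁ (τ₁ ≫ σ') (j₂ '' closure (υ ⁻¹' (T₁ \ Z))))
    -- ===================== THE ONE NAMED INPUT: (T-k), the registered NEED-FACT instantiated over `q` =====================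
    -- (T-k) the embedded-curve lift at every stage / exceptional surface over `q` (res-L1-w45b-lead-2 …NatTowerRoundFourDefs p594791)
    (hFact : EmbeddedCurveLift O k θ P q) :
    -- ===================== THE CONCLUSION OF HSUB″(ReachNoseTowerB″)₃ =====================
    ∀ (F' : Scheme.{0}) (γ' : F' ⟶ F₂) (T' E' K' : Set F'),
      (∃ Es' : List (Set F'), ∀ R₁ : (∀ G : Scheme.{0}, (G ⟶ F₂) → Set G → Set G → List (Set G) → Set G → Prop),
        R₁ F₂ (𝟙 F₂) (closure (υ ⁻¹' (T₁ \ Z))) (υ ⁻¹' Z) [] ∅ → TowerPtRegB F₁ F₂ υ R₁ → TowerPtRamB F₁ F₂ υ R₁ →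
        TowerRoundBDoublePrime F₁ F₂ υ Z hZ R₁ → R₁ F' γ' T' E' Es' K') →
      ∃ (X₉ : Scheme.{0}) (σ₉ : X₉ ⟶ P) (S₉ : Set X₉) (j₉ : F' ⟶ X₉) (t₉ : F' ⟶ Spec (.of k)),
        Ch X₉ σ₉ S₉ ∧ IsIntegral X₉ ∧ IsLocallyNoetherian X₉ ∧ Scheme.IsRegular X₉ ∧ IsDominant (σ₉ ≫ q) ∧
        IsPullback j₉ t₉ (σ₉ ≫ q) (Spec.map (CommRingCat.ofHom θ)) ∧ j₉ '' T' = S₉ ∧ IsClosed T' ∧ IsIrreducible T' ∧ IsIntegral F' := by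
  classical
  haveI := hPint
  haveI := hqprop
  haveI := hqsm
  haveI := hX'noeth
  haveI := hX₁int
  haveI := hX₁noeth
  haveI := hF₂
  -- the exceptional-surface datum of the ₇ engine (= V8's `FE`): `O`-FLATNESS of the upstairs model of the running exceptional surface
  let FE : Tower.RuledDatum P := fun _ _ _ _ _ _ _ _ _ σ _ 𝓔 => Flat (𝓔.subschemeι ≫ σ ≫ q)
  -- its BIRTH at a centre blow-up (…CentreBlowupFlatExceptional) and its TRANSPORT along an isomorphism over the step
  have hFEbirth : ∀ {X X'' : Scheme.{0}} [IsLocallyNoetherian X] (σ : X ⟶ P) (C : X.IdealSheafData) (τ : X'' ⟶ X),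
      Scheme.IsRegular X → Scheme.IsRegular C.subscheme → Flat (C.subschemeι ≫ σ ≫ q) → IsBlowup τ C →
      Flat ((C.comap τ).subschemeι ≫ (τ ≫ σ) ≫ q) := by
    intro X X'' _ σ C τ hXreg hCreg hCflat hτ
    rw [Category.assoc]
    exact flat_exceptional_of_isBlowup_regularCentre O X X'' (σ ≫ q) C hXreg hCreg hCflat τ hτ
  have hFEiso : ∀ {X X'' : Scheme.{0}} (σ : X ⟶ P) (I : X.IdealSheafData) (τ : X'' ⟶ X) (I'' : X''.IdealSheafData),
      (∃ e : I''.subscheme ≅ I.subscheme, e.hom ≫ I.subschemeι = I''.subschemeι ≫ τ) →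
      Flat (I.subschemeι ≫ σ ≫ q) → Flat (I''.subschemeι ≫ (τ ≫ σ) ≫ q) := by
    intro X X'' σ I τ I'' he hflat
    obtain ⟨e, he⟩ := he
    have heq : I''.subschemeι ≫ (τ ≫ σ) ≫ q = e.hom ≫ I.subschemeι ≫ σ ≫ q := by
      rw [← Category.assoc e.hom, he]; simp only [Category.assoc]
    rw [heq]
    infer_instance
  -- INV₁B (B-tower, at the datum `FE`): `Tower.InvB` ∧ side facts ∧ the carrier-dimension datum
  let INV₁ : ∀ (F₉ : Scheme.{0}) (Z₉ : Set F₉), IsClosed Z₉ → ∀ (F₁₀ : Scheme.{0}), (F₁₀ ⟶ F₉) →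
      ∀ G : Scheme.{0}, (G ⟶ F₁₀) → Set G → Set G → List (Set G) → Set G → Prop :=
    fun F₉ Z₉ hZ₉ F₁₀ υ' G γ T E Es K => (Tower.InvB O k θ P q Y Ch FE F₉ Z₉ hZ₉ F₁₀ υ' G γ T E Es K ∧
      IsClosed K ∧ K ⊆ closure (K \ E) ∧ K ≠ Set.univ) ∧
      (∀ z : ↥(redSub F₉ Z₉ hZ₉), IsClosed ({z} : Set ↥(redSub F₉ Z₉ hZ₉)) →
        ringKrullDim ((redSub F₉ Z₉ hZ₉).presheaf.stalk z) = ((1 : ℕ) : WithBot ℕ∞))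
  -- the nose's carrier-dimension datum IS the hypothesis `hZdim` (revision ₇): no stand-in, no `ℙ¹`
  -- `F₁` is locally Noetherian (a closed subscheme of `X'`: base change of the closed immersion `Spec k → Spec O`) — B3 needs it at the root
  haveI : IsClosedImmersion (Spec.map (CommRingCat.ofHom θ)) := IsClosedImmersion.spec_of_surjective _ hθ
  haveI : IsClosedImmersion j := MorphismProperty.IsStableUnderBaseChange.of_isPullback hsq.flip inferInstance
  haveI hF₁noeth : IsLocallyNoetherian F₁ := LocallyOfFiniteType.isLocallyNoetherian j
  -- the iso-invariance of the datum `FE`, in the shape the B point clauses consume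
  have hFEisoC : ∀ {F₉ : Scheme.{0}} (Z₉ : Set F₉) (hZ₉ : IsClosed Z₉) {F₁₀ : Scheme.{0}} (υ' : F₁₀ ⟶ F₉),
      ∀ (G₀ G₀' : Scheme.{0}) (γ₀ : G₀ ⟶ F₁₀) (γ₀' : G₀' ⟶ F₁₀) (E₀ : Set G₀) (E₀' : Set G₀') (X₀ X₀'' : Scheme.{0})
        (σ₀ : X₀ ⟶ P) (j₀ : G₀ ⟶ X₀) (j₀' : G₀' ⟶ X₀'') (𝓔₀ : X₀.IdealSheafData) (τ₀ : X₀'' ⟶ X₀),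
      (∃ e : (𝓔₀.comap τ₀).subscheme ≅ 𝓔₀.subscheme, e.hom ≫ 𝓔₀.subschemeι = (𝓔₀.comap τ₀).subschemeι ≫ τ₀) →
      FE F₉ Z₉ hZ₉ F₁₀ υ' G₀ γ₀ E₀ X₀ σ₀ j₀ 𝓔₀ → FE F₉ Z₉ hZ₉ F₁₀ υ' G₀' γ₀' E₀' X₀'' (τ₀ ≫ σ₀) j₀' (𝓔₀.comap τ₀) := by
    intro F₉ Z₉ hZ₉ F₁₀ υ' G₀ G₀' γ₀ γ₀' E₀ E₀' X₀ X₀'' σ₀ j₀ j₀' 𝓔₀ τ₀ he hR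
    exact hFEiso σ₀ 𝓔₀ τ₀ (𝓔₀.comap τ₀) he hR
  -- (seed): res-D-pv-035's GENERIC `Tower.inv₂_noseSeed'` at `FE` (datum BORN at the nose blow-up), pushed to `Inv₃` by `Tower.inv₂_inv₃`
  have hseed : INV₁ F₁ Z hZ F₂ υ F₂ (𝟙 F₂) (closure (υ ⁻¹' (T₁ \ Z))) (υ ⁻¹' Z) [] ∅ := by
    refine ⟨?_, hZdim⟩
    obtain ⟨h₁, h₂⟩ := Tower.inv₂_noseSeed' O k θ hθ P q Y Ch FE X' σ' hX'noeth hX'reg F₁ j t hsq T₁ Z hZ hT₁Z hZinf C hCreg hCj hCoff X₁ τ₁ hτ₁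
      hX₁int hX₁noeth hX₁reg hX₁dom F₂ hF₂ υ hυ j₂ t₂ hsq₂ hcomm hirr₂ hCh₁ (hFEbirth σ' C τ₁ hX'reg hCreg hCfl hτ₁)
    exact ⟨Tower.invB_nil_of_inv₃ O k θ P q Y Ch FE F₁ Z hZ F₂ υ F₂ (𝟙 F₂) _ _ _
      (Tower.inv₂_inv₃ O k θ P q Y Ch FE F₁ Z hZ F₂ υ F₂ (𝟙 F₂) _ _ _ h₁), h₂⟩
  have hptreg : ∀ (F₉ : Scheme.{0}) (Z₉ : Set F₉) (hZ₉ : IsClosed Z₉) (F₁₀ : Scheme.{0}) (υ' : F₁₀ ⟶ F₉),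
      TowerPtRegB F₉ F₁₀ υ' (INV₁ F₉ Z₉ hZ₉ F₁₀ υ') := by
    intro F₉ Z₉ hZ₉ F₁₀ υ' G G' γ T E Es K y υ₂ hy K' E' Es' hinv hTreg hGreg hυ₂ hK' hE' hEs'
    obtain ⟨⟨hinv, hKcl, hKE, hKne⟩, hcar⟩ := hinv
    have hI₂ := Tower.towerPtRegB_invB O k θ hθ P q Y hYsp hYirr hYcl hPnoeth hPreg Ch hChSplit hChStep FE F₉ Z₉ hZ₉ F₁₀ υ'
      (hFEisoC Z₉ hZ₉ υ') G G' γ T E Es K y υ₂ hy K' E' Es' hinv hTreg hGreg hυ₂ hK' hE' hEs'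
    refine (fun h3 => ⟨⟨hI₂, h3⟩, hcar⟩) ?_
    obtain ⟨-, -, hGint, -, hTirr, hEcl, hTE, -⟩ := hinv
    obtain ⟨-, -, hG'int, -⟩ := hI₂
    haveI := hGint
    haveI := hG'int
    have hTy : ¬ T ⊆ {curvePt G T y} := not_subset_singleton_of_not_isRegularLocalRing_stalk y hTreg hy
    have hDsupp : ((vanishingIdeal (⟨{curvePt G T y}, hy⟩ : Closeds G) : G.IdealSheafData).support : Set G) = {curvePt G T y} :=
      Scheme.IdealSheafData.coe_support_vanishingIdeal _
    rcases hK' with rfl | ⟨hyK, rfl⟩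
    · exact ⟨isClosed_empty, by simp, Set.empty_ne_univ⟩
    · refine ⟨isClosed_closure, ?_, closure_preimage_ne_univ υ₂ _ hυ₂ K {curvePt G T y} hKcl hKne hy
        (fun h => hTy (h ▸ Set.subset_univ _)) hDsupp.le _ (Set.preimage_mono fun z hz => hz.1)⟩
      rcases hE' with rfl | ⟨-, rfl⟩
      · exact closure_preimage_diff_subset_closure_diff_preimage υ₂ K {curvePt G T y}
      · have h := closure_preimage_diff_subset_of_isBlowup υ₂ (vanishingIdeal (⟨{curvePt G T y}, hy⟩ : Closeds G)) hυ₂ K E hEcl hKE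
        rw [hDsupp] at h
        exact h

  have hptram : ∀ (F₉ : Scheme.{0}) (Z₉ : Set F₉) (hZ₉ : IsClosed Z₉) (F₁₀ : Scheme.{0}) (υ' : F₁₀ ⟶ F₉),
      TowerPtRamB F₉ F₁₀ υ' (INV₁ F₉ Z₉ hZ₉ F₁₀ υ') := by
    intro F₉ Z₉ hZ₉ F₁₀ υ' G G' γ T E Es K y J υ₂ K' E' Es' hinv hTreg hGreg hJsupp hJgen hυ₂ hK' hE' hEs'
    obtain ⟨⟨hinv, hKcl, hKE, hKne⟩, hcar⟩ := hinv
    have hI₂ := Tower.towerPtRamB_invB O k θ hθ P q Y hYsp hYirr hYcl hPnoeth hPreg Ch hChSplit hChStep FE F₉ Z₉ hZ₉ F₁₀ υ'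
      (hFEisoC Z₉ hZ₉ υ') G G' γ T E Es K y J υ₂ K' E' Es' hinv hTreg hGreg hJsupp hJgen hυ₂ hK' hE' hEs'
    refine (fun h3 => ⟨⟨hI₂, h3⟩, hcar⟩) ?_
    obtain ⟨-, -, hGint, -, hTirr, hEcl, hTE, -⟩ := hinv
    obtain ⟨-, -, hG'int, -⟩ := hI₂
    haveI := hGint
    haveI := hG'int
    have hyc : IsClosed ({curvePt G T y} : Set G) := hJsupp ▸ J.support.isClosed
    have hTy : ¬ T ⊆ {curvePt G T y} := not_subset_singleton_of_not_isRegularLocalRing_stalk y hTreg hyc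
    rcases hK' with rfl | ⟨hyK, rfl⟩
    · exact ⟨isClosed_empty, by simp, Set.empty_ne_univ⟩
    · refine ⟨isClosed_closure, ?_, closure_preimage_ne_univ υ₂ _ hυ₂ K {curvePt G T y} hKcl hKne hyc
        (fun h => hTy (h ▸ Set.subset_univ _)) hJsupp.le _ (Set.preimage_mono fun z hz => hz.1)⟩
      rcases hE' with rfl | ⟨-, rfl⟩
      · exact closure_preimage_diff_subset_closure_diff_preimage υ₂ K {curvePt G T y}
      · have h := closure_preimage_diff_subset_of_isBlowup υ₂ J hυ₂ K E hEcl hKE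
        rw [hJsupp] at h
        exact h

  -- (round) ALL THREE branches of `TowerRoundBDoublePrime` — the shared closure of …NatTowerBDoublePrimeRoundClosure (A′ rounds of fact + the PAIR round)
  have hround : ∀ (F₉ : Scheme.{0}) (Z₉ : Set F₉) (hZ₉ : IsClosed Z₉) (F₁₀ : Scheme.{0}) (υ' : F₁₀ ⟶ F₉) [IsLocallyNoetherian F₉],
      TowerRoundBDoublePrime F₉ F₁₀ υ' Z₉ hZ₉ (INV₁ F₉ Z₉ hZ₉ F₁₀ υ') := fun F₉ Z₉ hZ₉ F₁₀ υ' _ =>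
    Tower.towerRoundBDoublePrime_invB_of_fact O k θ hθ P q Y hYsp hYirr hYcl hPnoeth hPreg Ch hChStep hChSplit hFact Z₉ hZ₉ υ' inferInstance

  -- the closure at `R₁ := INV₁ F₁ Z hZ F₂ υ`, then (final) := `Tower.invB_final ∘ And.left`
  intro F' γ' T' E' K' hcl
  obtain ⟨Es', hcl⟩ := hcl
  have h' : INV₁ F₁ Z hZ F₂ υ F' γ' T' E' Es' K' :=
    hcl (INV₁ F₁ Z hZ F₂ υ) hseed (hptreg F₁ Z hZ F₂ υ) (hptram F₁ Z hZ F₂ υ) (hround F₁ Z hZ F₂ υ)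
  exact Tower.invB_final O k θ P q Y Ch FE F₁ Z hZ F₂ υ F' γ' T' E' Es' K' h'.1.1

end Summit.ResolutionOfSingularities.ResolutionOfSingularities.Cruxes.EquisingularLiftNat.Sections

end
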